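import Summits.BirchSwinnertonDyer.Rank1Residual.Additive.X3BranchLayerCyclotomicValuation
import Mathlib.NumberTheory.NumberField.Cyclotomic.Ideal
import Mathlib.RingTheory.Flat.TorsionFree
import HarnessLib

/-!
# X3 degenerate road, brick U4: primes of the layer `ℚ_N` above a tame prime `ℓ`
# (cell `bsd-eis`, seat `bsd-eis-x3` gen 9; route K1 `AdditiveBranchIMC`, crux `GordTwoRankZeroOffCaseOne`
# — supports only; THEOREMS ONLY)

HONEST FRAMING (`run/shared/lean/pub/bsd-eis/README.md` §4): the programme's target of record is the full
Birch–Swinnerton-Dyer formula for every `E/ℚ` of analytic rank `≤ 1`; this file is one brick (U4 of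
`x3-MEMO-11.md` §2) of the CLASS-LEVEL lower bound `3^{σ(S₀)−1} ≤ #U(W[3]/Φ₀)` on the degenerate
X3♯(G-ord) rows at `p = 3`: the number of primes of the layer `ℚ_N` of the cyclotomic `ℤ_p`-extension
above a prime `ℓ ≠ p` is at least `p^m` as soon as `m ≤ N` and `p^{m+1} ∣ ℓ^{p−1} − 1`
(`ℓ` splits completely in `ℚ_m ⊆ ℚ(ζ_{p^{m+1}})` because its Frobenius `ℓ mod p^{m+1}` has order
dividing `p − 1`, prime to `[ℚ_m : ℚ] = p^m`).  In particular `#{w ∣ ℓ} ≥ s_ℓ = p^{v_p(ℓ^{p−1}−1)−1}`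
(`= GreenbergVatsal2000.sFactor p ℓ`, GV's "number of primes of `ℚ_∞` above `ℓ`") as soon as
`p ∙ s_ℓ ≤ p^{N+1}`.  Nothing is booked here.
References: [Washington1997] §13.1, Thm. 2.13; [GreenbergVatsal2000] §2 p. 30.
-/

set_option autoImplicit false

noncomputable section

open scoped Classical NumberField

namespace Summit.BirchSwinnertonDyer.Rank1Residual.Additive

namespace KummerFamily

open NumberField IsDedekindDomain Ideal

/-- **Complete splitting below a cyclotomic field.**  Let `K/ℚ` be Galois of degree `p^j`, mapping into
a cyclotomic field `L = ℚ(ζ_n)` with `ℓ ∤ n`, and suppose the order of `ℓ mod n` divides `p − 1`.  Then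
`(ℓ)` splits into exactly `p^j = [K : ℚ]` primes of `K`: `e(w|ℓ) ∣ e_L(ℓ) = 1`,
`f(w|ℓ) ∣ f_L(ℓ) = ord(ℓ mod n) ∣ p − 1` and `f(w|ℓ) ∣ p^j` force `e = f = 1` in `#{w} · e · f = p^j`.
[cite: Washington1997, Thm. 2.13 and §13.1] -/
theorem ncard_primesOver_eq_pow_of_algebra_cyclotomic {L : Type} [Field L] [NumberField L] {n : ℕ}
    [NeZero n] [hcyc : IsCyclotomicExtension {n} ℚ L] (p j ℓ : ℕ) [hp : Fact p.Prime]
    [hℓ : Fact ℓ.Prime] (hℓn : ¬ ℓ ∣ n) (hord : orderOf (ℓ : ZMod n) ∣ p - 1)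
    (K : Type) [Field K] [NumberField K] [Algebra K L] [IsGalois ℚ K]
    (hK : Module.finrank ℚ K = p ^ j) :
    (primesOver (span {(ℓ : ℤ)}) (𝓞 K)).ncard = p ^ j := by
  haveI : Module.Finite K L := Module.Finite.of_restrictScalars_finite ℚ K L
  have hℓmax : (span {(ℓ : ℤ)}).IsMaximal :=
    IsPrime.isMaximal
      ((span_singleton_prime (by exact_mod_cast hℓ.out.ne_zero)).mpr
        (Nat.prime_iff_prime_int.mp hℓ.out))
      (by rw [Ne, span_singleton_eq_bot]; exact_mod_cast hℓ.out.ne_zero)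
  haveI := hℓmax
  -- the fundamental identity for the Galois extension `K/ℚ`
  have hmain := ncard_primesOver_mul_ramificationIdxIn_mul_inertiaDegIn (span {(ℓ : ℤ)}) (𝓞 K)
    (K ≃ₐ[ℚ] K)
  obtain ⟨⟨w, hwP, hwover⟩⟩ := (span {(ℓ : ℤ)}).nonempty_primesOver (S := 𝓞 K)
  haveI := hwP
  haveI := hwover
  haveI : w.IsMaximal := IsMaximal.of_liesOver_isMaximal w (span {(ℓ : ℤ)})
  -- a prime `Q` of `L` above `w`
  obtain ⟨Q, hQmax, hQover⟩ := exists_maximal_ideal_liesOver_of_isIntegral (S := 𝓞 L) w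
  haveI := hQover
  haveI : Q.IsPrime := hQmax.isPrime
  haveI : Q.LiesOver (span {(ℓ : ℤ)}) := LiesOver.trans Q w _
  -- `e(Q|ℓ) = 1`, `f(Q|ℓ) = ord(ℓ mod n)` in the cyclotomic field
  have heQ : Q.ramificationIdx ℤ = 1 := IsCyclotomicExtension.Rat.ramificationIdx_eq_of_not_dvd ℓ L Q hℓn
  have hfQ : Q.inertiaDeg ℤ = orderOf (ℓ : ZMod n) :=
    IsCyclotomicExtension.Rat.inertiaDeg_eq_of_not_dvd ℓ L Q hℓn
  -- divisibilities along the tower `ℤ ⊆ 𝓞 K ⊆ 𝓞 L`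
  have hediv : w.ramificationIdx ℤ ∣ Q.ramificationIdx ℤ := ramificationIdx_below_dvd w Q
  have hfdiv : w.inertiaDeg ℤ ∣ Q.inertiaDeg ℤ := inertiaDeg_below_dvd w Q
  rw [heQ, Nat.dvd_one] at hediv
  rw [hfQ] at hfdiv
  replace hfdiv : w.inertiaDeg ℤ ∣ p - 1 := dvd_trans hfdiv hord
  rw [ramificationIdxIn_eq_ramificationIdx (span {(ℓ : ℤ)}) w (K ≃ₐ[ℚ] K),
    inertiaDegIn_eq_inertiaDeg (span {(ℓ : ℤ)}) w (K ≃ₐ[ℚ] K), hediv, one_mul,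
    IsGaloisGroup.card_eq_finrank (K ≃ₐ[ℚ] K) ℚ K, hK] at hmain
  -- `f(w|ℓ) ∣ p^j` and `f(w|ℓ) ∣ p − 1` ⇒ `f(w|ℓ) = 1`
  have hfpow : w.inertiaDeg ℤ ∣ p ^ j := Dvd.intro_left _ hmain
  obtain ⟨i, hi, hfi⟩ := (Nat.dvd_prime_pow hp.out).mp hfpow
  have hf1 : w.inertiaDeg ℤ = 1 := by
    rcases Nat.eq_zero_or_pos i with h0 | hpos
    · rw [hfi, h0, pow_zero]
    · exfalso
      have hpd : p ∣ p - 1 := dvd_trans (hfi ▸ dvd_pow_self p hpos.ne') hfdiv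
      have h1 : 0 < p - 1 := Nat.sub_pos_of_lt hp.out.one_lt
      have := Nat.le_of_dvd h1 hpd
      omega
  rw [hf1, mul_one] at hmain
  exact hmain

/-- **Primes above a fixed prime of `ℤ` can only become more numerous up a tower `K → K'` of number
fields**: each prime `P` of `K` over `I` has a prime `Q` of `K'` above it, and `Q ↦ Q ∩ 𝓞_K = P` makes
the choice injective. [folklore] -/
theorem ncard_primesOver_le_of_algebra (K K' : Type) [Field K] [NumberField K] [Field K']
    [NumberField K'] [Algebra K K'] (I : Ideal ℤ) [I.IsMaximal] :
    (primesOver I (𝓞 K)).ncard ≤ (primesOver I (𝓞 K')).ncard := by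
  have key : ∀ P : primesOver I (𝓞 K), ∃ Q : primesOver I (𝓞 K'), Q.1.under (𝓞 K) = P.1 := by
    rintro ⟨P, hP, hPover⟩
    haveI := hP
    haveI := hPover
    haveI : P.IsMaximal := IsMaximal.of_liesOver_isMaximal P I
    obtain ⟨Q, hQmax, hQover⟩ := exists_maximal_ideal_liesOver_of_isIntegral (S := 𝓞 K') P
    haveI := hQover
    haveI : Q.IsPrime := hQmax.isPrime
    exact ⟨⟨Q, hQmax.isPrime, LiesOver.trans Q P I⟩, hQover.over.symm⟩
  choose f hf using key
  have hinj : Function.Injective f := by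
    intro P₁ P₂ h
    apply Subtype.ext
    rw [← hf P₁, ← hf P₂, h]
  rw [← Nat.card_coe_set_eq, ← Nat.card_coe_set_eq]
  haveI : Finite (primesOver I (𝓞 K')) := (IsDedekindDomain.primesOver_finite I (𝓞 K')).to_subtype
  exact Nat.card_le_card_of_injective f hinj

/-- A prime of `𝓞_K` lying over `(ℓ) ⊆ ℤ` contains `ℓ`. [folklore] -/
theorem natCast_mem_of_liesOver_span (K : Type) [Field K] [NumberField K] (ℓ : ℕ)
    (P : Ideal (𝓞 K)) [hP : P.LiesOver (span {(ℓ : ℤ)})] : (ℓ : 𝓞 K) ∈ P := by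
  have h : (ℓ : ℤ) ∈ P.under ℤ := by
    rw [← hP.over]; exact mem_span_singleton_self _
  rw [mem_comap, map_natCast] at h
  exact h

/-- **The primes `w` of `𝓞_K` with `ℓ ∈ w` (as height-one primes) are exactly the primes over `(ℓ) ⊆ ℤ`**:
the two counts agree. [folklore] -/
theorem natCard_primes_natCast_mem_eq_ncard_primesOver (K : Type) [Field K] [NumberField K] (ℓ : ℕ)
    [hℓ : Fact ℓ.Prime] :
    Nat.card {w : HeightOneSpectrum (𝓞 K) // (ℓ : 𝓞 K) ∈ w.asIdeal} =
      (primesOver (span {(ℓ : ℤ)}) (𝓞 K)).ncard := by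
  rw [← Nat.card_coe_set_eq]
  refine Nat.card_congr
    { toFun := fun w => ⟨w.1.asIdeal, w.1.isPrime, liesOver_span_of_natCast_mem K ℓ w.1 w.2⟩
      invFun := fun P => ⟨⟨P.1, P.2.1, ?_⟩, @natCast_mem_of_liesOver_span K _ _ ℓ P.1 P.2.2⟩
      left_inv := fun w => rfl
      right_inv := fun P => rfl }
  intro hbot
  have hmem := @natCast_mem_of_liesOver_span K _ _ ℓ P.1 P.2.2
  rw [hbot, mem_bot] at hmem
  exact (Nat.cast_ne_zero.mpr hℓ.out.ne_zero) hmem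

end KummerFamily

end Summit.BirchSwinnertonDyer.Rank1Residual.Additive

namespace Literature.NumberTheory.EllipticCurves.ZpExtension

open Field NumberField IsDedekindDomain Literature.NumberTheory.GaloisRepresentations
  Summit.BirchSwinnertonDyer.Rank1Residual.Additive

variable {p : ℕ} [hp : Fact p.Prime] {κ : ZpExtension ℚ p}

/-- **At least `p^m` primes of the layer `ℚ_N` lie above `ℓ`** whenever `m ≤ N` and
`p^{m+1} ∣ ℓ^{p−1} − 1` (`κ` cyclotomic, `p` odd, `ℓ ≠ p` prime): `ℓ` splits completely in
`ℚ_m ⊆ ℚ(ζ_{p^{m+1}})` (`KummerFamily.ncard_primesOver_eq_pow_of_algebra_cyclotomic` — the order of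
`ℓ mod p^{m+1}` divides `p − 1`), and primes only multiply up to `ℚ_N`.
[cite: Washington1997, §13.1 and Thm. 2.13] [cite: GreenbergVatsal2000, §2 p. 30] -/
theorem IsCyclotomic.pow_le_natCard_primes_layer (hκ : κ.IsCyclotomic) (hp2 : p ≠ 2) {ℓ : ℕ}
    [hℓ : Fact ℓ.Prime] (hℓp : ℓ ≠ p) {m N : ℕ} (hmN : m ≤ N) (hdiv : p ^ (m + 1) ∣ ℓ ^ (p - 1) - 1) :
    haveI : FiniteDimensional ℚ (κ.layer N) := κ.finiteDimensional_layer_holds N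
    haveI : NumberField (κ.layer N) := NumberField.of_module_finite ℚ (κ.layer N)
    p ^ m ≤ Nat.card {w : HeightOneSpectrum (𝓞 (κ.layer N)) // (ℓ : 𝓞 (κ.layer N)) ∈ w.asIdeal} := by
  haveI : FiniteDimensional ℚ (κ.layer N) := κ.finiteDimensional_layer_holds N
  haveI : NumberField (κ.layer N) := NumberField.of_module_finite ℚ (κ.layer N)
  haveI : FiniteDimensional ℚ (κ.layer m) := κ.finiteDimensional_layer_holds m
  haveI : NumberField (κ.layer m) := NumberField.of_module_finite ℚ (κ.layer m)
  haveI : NeZero (p ^ (m + 1)) := ⟨pow_ne_zero _ hp.out.ne_zero⟩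
  obtain ⟨ζ, hζ⟩ := HasEnoughRootsOfUnity.exists_primitiveRoot (AlgebraicClosure ℚ) (p ^ (m + 1))
  set L := @IntermediateField.adjoin ℚ _ (AlgebraicClosure ℚ) _ (AlgebraicClosure.instAlgebra ℚ) {ζ}
    with hL
  haveI : @Algebra.IsIntegral ℚ (AlgebraicClosure ℚ) _ _ (AlgebraicClosure.instAlgebra ℚ) :=
    Algebra.isAlgebraic_iff_isIntegral.mp (AlgebraicClosure.isAlgebraic ℚ)
  haveI : IsCyclotomicExtension {p ^ (m + 1)} ℚ L :=
    IsPrimitiveRoot.intermediateField_adjoin_isCyclotomicExtension (K := ℚ) hζ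
  haveI : FiniteDimensional ℚ L :=
    IntermediateField.adjoin.finiteDimensional (Algebra.IsIntegral.isIntegral ζ)
  haveI : NumberField L := NumberField.of_module_finite ℚ L
  have hle : κ.layer m ≤ L := hκ.layer_le_adjoin hp2 m hζ
  letI : Algebra (κ.layer m) L := (IntermediateField.inclusion hle).toRingHom.toAlgebra
  letI : Algebra (κ.layer m) (κ.layer N) :=
    (IntermediateField.inclusion (κ.layer_mono hmN)).toRingHom.toAlgebra
  haveI : IsGalois ℚ (κ.layer m) := κ.isGalois_layer_holds m
  -- the Frobenius `ℓ mod p^{m+1}` has order dividing `p − 1`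
  have hℓn : ¬ ℓ ∣ p ^ (m + 1) := fun h =>
    hℓp ((Nat.prime_dvd_prime_iff_eq hℓ.out hp.out).mp (hℓ.out.dvd_of_dvd_pow h))
  have h1 : 1 ≤ ℓ ^ (p - 1) := Nat.one_le_pow _ _ hℓ.out.pos
  have hmod : ((ℓ ^ (p - 1) : ℕ) : ZMod (p ^ (m + 1))) = 1 := by
    obtain ⟨c, hc⟩ := hdiv
    have : ℓ ^ (p - 1) = p ^ (m + 1) * c + 1 := by omega
    rw [this, Nat.cast_add, Nat.cast_mul, ZMod.natCast_self, zero_mul, zero_add, Nat.cast_one]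
  have hpow : (ℓ : ZMod (p ^ (m + 1))) ^ (p - 1) = 1 := by exact_mod_cast hmod
  have hord : orderOf (ℓ : ZMod (p ^ (m + 1))) ∣ p - 1 := orderOf_dvd_of_pow_eq_one hpow
  have hcount := KummerFamily.ncard_primesOver_eq_pow_of_algebra_cyclotomic (L := L) p m ℓ hℓn hord
    (κ.layer m) (κ.finrank_layer_holds m)
  have hℓmax : (Ideal.span {(ℓ : ℤ)}).IsMaximal :=
    Ideal.IsPrime.isMaximal
      ((Ideal.span_singleton_prime (by exact_mod_cast hℓ.out.ne_zero)).mpr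
        (Nat.prime_iff_prime_int.mp hℓ.out))
      (by rw [Ne, Ideal.span_singleton_eq_bot]; exact_mod_cast hℓ.out.ne_zero)
  haveI := hℓmax
  rw [KummerFamily.natCard_primes_natCast_mem_eq_ncard_primesOver, ← hcount]
  exact KummerFamily.ncard_primesOver_le_of_algebra (κ.layer m) (κ.layer N) _

/-- **`#{w ∣ ℓ in ℚ_N} ≥ s_ℓ = p^{v_p(ℓ^{p−1}−1) − 1}`** (`= GreenbergVatsal2000.sFactor p ℓ` by `rfl`)
once `p^{N+1} ≥ p^{v_p(ℓ^{p−1}−1)}`, i.e. once the layer `ℚ_N` already sees all `s_ℓ` primes of `ℚ_∞`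
above `ℓ` (`κ` cyclotomic, `p` odd, `ℓ ≠ p` prime); `v_p(ℓ^{p−1} − 1) ≥ 1` is Fermat's little theorem.
[cite: GreenbergVatsal2000, §2 Prop. (2.4) (p. 22) and p. 30] [cite: Washington1997, §13.1] -/
theorem IsCyclotomic.pow_padicValNat_le_natCard_primes_layer (hκ : κ.IsCyclotomic) (hp2 : p ≠ 2) {ℓ : ℕ}
    [hℓ : Fact ℓ.Prime] (hℓp : ℓ ≠ p) {N : ℕ} (hN : padicValNat p (ℓ ^ (p - 1) - 1) ≤ N + 1) :
    haveI : FiniteDimensional ℚ (κ.layer N) := κ.finiteDimensional_layer_holds N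
    haveI : NumberField (κ.layer N) := NumberField.of_module_finite ℚ (κ.layer N)
    p ^ (padicValNat p (ℓ ^ (p - 1) - 1) - 1) ≤
      Nat.card {w : HeightOneSpectrum (𝓞 (κ.layer N)) // (ℓ : 𝓞 (κ.layer N)) ∈ w.asIdeal} := by
  haveI : Fact p.Prime := hp
  -- Fermat: `p ∣ ℓ^{p−1} − 1`, so `v := v_p(ℓ^{p−1} − 1) ≥ 1` and `p^v ∣ ℓ^{p−1} − 1`
  have h1 : 1 ≤ ℓ ^ (p - 1) := Nat.one_le_pow _ _ hℓ.out.pos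
  have hℓ0 : (ℓ : ZMod p) ≠ 0 := by
    rw [Ne, ZMod.natCast_eq_zero_iff]
    exact fun h => hℓp ((Nat.prime_dvd_prime_iff_eq hp.out hℓ.out).mp h).symm
  have hF : (ℓ : ZMod p) ^ (p - 1) = 1 := ZMod.pow_card_sub_one_eq_one hℓ0
  have hpd : p ∣ ℓ ^ (p - 1) - 1 := by
    rw [← ZMod.natCast_eq_zero_iff, Nat.cast_sub h1, Nat.cast_pow, hF, Nat.cast_one, sub_self]
  have hgt : 1 < ℓ ^ (p - 1) := Nat.one_lt_pow (Nat.sub_ne_zero_of_lt hp.out.one_lt) hℓ.out.one_lt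
  have hne : ℓ ^ (p - 1) - 1 ≠ 0 := by omega
  have hv : 1 ≤ padicValNat p (ℓ ^ (p - 1) - 1) := one_le_padicValNat_of_dvd hne hpd
  have hdiv : p ^ (padicValNat p (ℓ ^ (p - 1) - 1) - 1 + 1) ∣ ℓ ^ (p - 1) - 1 := by
    rw [Nat.sub_add_cancel hv]; exact pow_padicValNat_dvd
  exact hκ.pow_le_natCard_primes_layer hp2 hℓp (m := padicValNat p (ℓ ^ (p - 1) - 1) - 1)
    (N := N) (by omega) hdiv

end Literature.NumberTheory.EllipticCurves.ZpExtension

end
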